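import Mathlib
import HarnessLib
import HarnessLib.Audit
import Summits.CriticalPhenomena.Statement
import Literature.Barriers.CriticalPhenomena.EmbeddingModulusUniqueness
import HarnessLib.Audit.Status.Attr

/-!
Route: CardyExpCovariance

DORMANT since 2026-08-24T05:42:02Z (reconciler: no traction for 6.6 d (last activity item-evidence-added at 2026-08-17T15:24:43Z); parked, not closed — `ledger route dormant route-CriticalPhenomena-CardyExpCovariance --off` to reactivat) — unstaffed, not closed; items shared with open routes are served there. `ledger route dormant <id> --off` reactivates.

# Route CardyExpCovariance — exp-covariance of Z2 crossings generates conformal invariance; the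
cylinder is the one conformal map a transfer matrix sees

X = SubseqConformalInvariance ("it suffices to show"): along every sequence δ_k → 0⁺ there is a
subsequence along which the
P_{1/2} bond-ℤ² crossing probabilities of ALL conformal rectangles converge simultaneously, to a
function f of the cross-ratio
(existence along common subsequences + conformal invariance of every subsequential limit; the value
is left free). Realises card
cylinder-exp-covariance (and the folded duplicate z2-is-its-own-logarithm): X is reached from ONE
non-Möbius covariance —
ExpCovariance: P_δ(R) − P_δ(exp R) → 0 whenever exp is injective on the closure of R, realised
exactly on the lattice because
exp((2π/N)ℤ²) IS the square lattice on the cylinder ℤ × ℤ_N — plus exact lattice translations, RSW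
equicontinuity in the domain
and a classical generation lemma (similarities, inversion and z^α are exp∘translate∘Log;
Koebe/zipper compositions reach every
Riemann map). The value F(η) is recovered by SEQUENTIAL Cardy rigidity (locality ⇒ SLE₆), which also
converts uniqueness of
subsequential limits into existence of the limit, so no separate LimitExists crux is needed.
Lean: `∀ u : ℕ → ℝ, Filter.Tendsto u Filter.atTop (nhdsWithin 0 (Set.Ioi 0)) → ∃ (ψ : ℕ → ℕ) (f : ℝ
→ ℝ), StrictMono ψ ∧ ∀ (R : Literature.Probability.RandomPlanarGeometry.ConformalRectangle) (φ :
Literature.Probability.RandomPlanarGeometry.ConformalEquiv UpperHalfPlane.upperHalfPlaneSet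
R.carrier) (x : Fin 4 → ℝ), R.IsUniformizing φ x → Filter.Tendsto (fun k ↦
Literature.Probability.Percolation.bondDomainCrossingProb R (u (ψ k))) Filter.atTop (nhds (f
(Literature.Probability.RandomPlanarGeometry.crossRatio x)))`

## Assembly
Pure logic, machine-checked as an `example` in the planner's Sketch.lean: fix R and a uniformizing
datum (φ, x); by
`Filter.tendsto_of_subseq_tendsto` (𝓝[>] 0 is countably generated) it suffices that every sequence
ns → 0⁺ has a subsequence along
which P(R) → F(crossRatio x); X gives ψ and f with convergence to f(crossRatio x') for all R', x';
CardyRigiditySeq applied to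
ns ∘ ψ gives f = F on (0,1); crossRatio x ∈ (0,1) by
`ConformalRectangle.crossRatio_mem_Ioo_of_isUniformizing`. The conjunct constant is
the root-level abbrev `CardyFormulaZ2` of Summits/CriticalPhenomena/CardyFormulaZ2/Statement.lean
(as in the sibling route files).
CardyRigiditySeq → CardyUniqueLimit.CardyRigidity is also checked there (u_k = 1/(k+1)).

Rationale: WHY THIS LINE. The only conformal self-map of the plane that the square lattice realises EXACTLY is
the exponential: for δ = 2π/N the polar web
exp(δℤ²) is the square lattice on the cylinder ℤ × ℤ_N, so "bond-ℤ² in R versus bond-ℤ² in exp R" is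
"cylinder lattice versus
planar lattice in one domain" — the log map is the reason periodic transfer-matrix spectra are
conformal data (Cardy1984), and
Langlands–Pouliot–Saint-Aubin tested precisely this annulus/cylinder identity numerically
(arXiv:math/9401222 §3.5, Table 3.5).
Exp-covariance of subsequential limits g already yields rotation AND scale invariance, g(λe^{iθ}R) =
g(exp(Log R + log λ + iθ))
= g(Log R) = g(R), so it subsumes DKKMO2020Rotational and the open scale-invariance cruxes of routes
CardyRotToConf / CardyViaSLE6,
and with translations it generates a pseudogroup (Möbius, z^α = exp(α Log z)) whose compositions
approximate every Riemann map
(Koebe osculation; zipper convergence MarshallRohde2007) — the typed generation lemma lands in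
Beffara's
`Literature.Barriers.CriticalPhenomena.IsModulusFunction` (Beffara2008Universal Def. 3). Imported
areas: constructive conformal
mapping (complex analysis) for ExpGeneratesConformal; SLE identification (Schramm2000,
LawlerSchrammWerner2001, CamiaNewman2007,
KemppainenSmirnov2017) for the value; and, as the intended attack on the rank-2 crux, finite-size
integrability of the Δ = −1/2
six-vertex / XXZ chain on the cylinder (arXiv:2603.06268 Thm 8, Cor 10, §4.5.1; Kozlowski2018), the
one setting in which a
covariance crux meets rigorous Bethe-ansatz technology. What prior routes do not do:
CardyUniqueLimit leaves X_U undecomposed and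
carries LimitExists as a separate open crux; CardyRotToConf/CardyViaSLE6 need scale invariance as an
input; here conformal
invariance is ONE functional equation on the explicit family (R, exp R), similarities are derived,
and existence follows from
uniqueness. Negatives index: nothing on this conjunct.

RANKED CRUXES. #0 SubseqConformalInvariance (target) — for every sequence u_k → 0⁺ there are a
subsequence ψ and f : ℝ → ℝ such that for every conformal rectangle R and every uniformizing datum
(φ, x) of R, bondDomainCrossingProb R (u (ψ k)) → f (crossRatio x) (card item X_U-subsequential;
existence along common subsequences + conformal invariance, value free). (why it might fail: As
strong as conformal invariance of all subsequential limits (open since LPSA 1994, B–R 2006 Ch.7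
Conj.1); fails only with Cardy itself or if G02's discretisation misbehaves on wild Jordan
boundaries (NegDegenerateArcs, stmt-CriticalPhenomena-0748).) [arXiv:math/9401222,
Beffara2008Universal, SchrammSmirnov2011, arXiv:0909.4499]
#2 ExpCovariance (crux) — for conformal rectangles R, R' with exp injective on closure(R.carrier),
R'.carrier = exp(R.carrier) and R'.pt i = exp(R.pt i), the bond-ℤ² crossing probabilities satisfy
P_δ(R) − P_δ(R') → 0 as δ → 0⁺ (card C1/C2 target: "polar web = cylinder lattice" makes P_δ(R) an
exact cylinder quantity; the comparison with the planar lattice in exp R is the content).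
[difficulty: open-problem] (why it might fail: Equivalent to conformal invariance minus existence
(it forces rotation AND scale invariance via Log); false for every stretched lattice diag(1,p)ℤ², so
only an embedding-specific input can prove it; LPS Table 3.5 saw a 1e-2 annulus/cylinder gap at r₁ =
100.) [arXiv:math/9401222, Cardy1984, arXiv:2603.06268, DKKMO2020Rotational, Beffara2008Universal]
#3 CardyRigiditySeq (crux) — sequential Cardy rigidity: if along SOME sequence u_k → 0⁺ the bond-ℤ²
crossing probabilities of every conformal rectangle converge to f(cross-ratio), then f =
cardyFunction on (0,1) (locality of percolation forces the exploration limit along u_k to be SLE₆,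
whose crossing law is Cardy's); strengthens CardyUniqueLimit.CardyRigidity
(stmt-CriticalPhenomena-0746: full-filter hypothesis) and is what turns uniqueness into existence.
[difficulty: L] (why it might fail: Needs the ℤ² 'crossing kernel ⇒ SLE₆' argument (Smirnov Thm 2 /
CN2007 §§5–7) with an unknown conformally invariant f, along one sequence and for Jordan (not
admissible moving-mesh) domains; CN2007 p.489 warn Jordan-only kernels may not suffice.)
[CamiaNewman2007, Schramm2000, LawlerSchrammWerner2001, KemppainenSmirnov2017, arXiv:0909.4499]
#4 ExpGeneratesConformal (crux) — generation lemma (pure complex analysis): a functional g on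
conformal rectangles that is (a) continuous under near-identity continuous injective perturbations h
of the closed marked domain (S.carrier = h(R.carrier), S.pt i = h(R.pt i), sup|h − id| ≤ η on
closure R), (b) invariant under translations, (c) invariant under R ↦ exp R whenever exp is
injective on closure(R.carrier) and (d) invariant under complex conjugation of the marked domain, is
a function of the conformal modulus (IsModulusFunction g; (d) is needed because uniformizing tuples
may be monotone or antitone and crossRatio is blind to x ↦ −x (crossRatio_neg), so equal
cross-ratios relate R, R' by a conformal OR anti-conformal map respecting labels — without (d) the
orientation sign of the labelled marks is a counterexample; (a) with h = id already makes g a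
function of (carrier, labelled marks)). Proof plan: (b)+(c) give similarities (exp∘(+c)∘Log),
inversion and powers z^α, hence all Möbius maps; Koebe osculation / slit-zipper compositions
approximate every map univalent near a closed disc uniformly (MarshallRohde2007); interior
exhaustion by the Riemann map + (a) passes g to the limit; (d) absorbs the anti-conformal case (card
item C3). [difficulty: M] (why it might fail: Hypothesis (a) must carry g through zipper/Koebe
approximants AND interior exhaustion of wild Jordan R, which needs Carathéodory's homeomorphic
boundary extension (tree facts exists_isUniformizing / exists_continuousOn_extension, unproved); a
too-weak topology in (a) makes it unprovable as typed.) [MarshallRohde2007, Beffara2008Universal,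
Pommerenke1992, lean:Literature.Barriers.CriticalPhenomena.IsModulusFunction]
#5 DomainEquicontinuity (crux) — RSW equicontinuity of bond-ℤ² crossing probabilities in the domain,
for G02's discretisation: for every conformal rectangle R and ε > 0 there are η, δ₀ > 0 such that
every near-identity perturbation S = h(R) (h continuous injective on closure R, marks mapped to
marks, sup|h − id| ≤ η) has |P_δ(S) − P_δ(R)| ≤ ε for all δ < δ₀ (Schramm–Smirnov quad-perturbation
stability transplanted to discreteCrossing; feeds both the diagonal extraction and hypothesis (a) of
the generation lemma). [difficulty: M] (why it might fail: SS11 Lemma 6.1 is proved for their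
quad-crossing events; G02's recipe (largest component of Ω∩δℤ², distance-assigned arcs) may break
uniformity over ALL η-perturbations when ∂R is wild or marks sit at cusps — same pathology as
NegDegenerateArcs.) [SchrammSmirnov2011, GarbanPeteSchramm2013, CamiaNewman2006, Grimmett1999]
#9 TranslationCovariance (support) — translation covariance in the limit: if S is the translate of R
by a ∈ ℂ (carrier and marked points), then P_δ(R) − P_δ(S) → 0 as δ → 0⁺ (exact for a ∈ δℤ² by
equivariance of discreteCrossing and of bondPercolation; the O(δ) remainder by
DomainEquicontinuity). [difficulty: provable-now] [SchrammSmirnov2011, Grimmett1999]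
#9 ReflectionSymmetry (support) — exact mirror symmetry: if S is the complex conjugate of R (carrier
conj(R.carrier), marked points conj(R.pt i)), then P_δ(S) = P_δ(R) for every δ (conj maps δℤ² to
itself; meshDomain takes the union of all maximal components, discreteArc compares distances — both
conj-equivariant; bondPercolation is invariant under the graph automorphism). Supplies hypothesis
(d) of the generation lemma. [difficulty: provable-now] [Smirnov2001, Grimmett1999]
#9 CovarianceGlue (support) — layer-2 glue: ExpCovariance → TranslationCovariance →
ReflectionSymmetry → DomainEquicontinuity → ExpGeneratesConformal → SubseqConformalInvariance
(diagonal extraction over a countable family of rational polygonal rectangles dense for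
near-identity perturbations; the subsequential limit functional g inherits (a)–(d);
IsModulusFunction g gives f by choice). [difficulty: M] [Beffara2008Universal, SchrammSmirnov2011]

TWO-LAYER PLAN. Foreseen glued split of the rank-2 crux (filed only after definitions land):
ExpCovariance ⇐ CylinderNestingGaussian →
PairIdentification → ExpCovariance. (C1) CylinderNestingGaussian — finite-aspect cylinder theorem:
for bond percolation on the
cylinder graph ℤ × ℤ_N drawn as the polar web exp((2π/N)ℤ²), the cos_μ-nesting transform E[∏_ℓ
2cos(φ(int ℓ) + π/3)] of its loops
(interior of a loop surrounding 0 = the disc containing 0, i.e. the lower end of the cylinder)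
converges for every mass-zero
finite-energy φ supported in ℂ∖0 to exp(−(3/2π)‖φ‖²_∇) — the SAME planar functional as DKLM Cor 10,
because Dirichlet energy is
conformally invariant and G_ℝ²∘(exp × exp) is the cylinder Green kernel mod constants; equivalently
GFF convergence on the flat
cylinder of the π/3-seam-twisted isotropic six-vertex height function (untwisted BKW gives wrapping
loops weight 2, the seam restores
2cos(π/3) = 1), to be attacked through the twisted Δ = −1/2 transfer matrix on ℤ_N (arXiv:2603.06268
§4.5.1 Lemma 22, Cor 18;
Kozlowski2018). (C2) PairIdentification — two subsequential loop limits in ℂ∖0, the planar one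
(translation invariant, DKKMO-rotation
invariant) and the polar-web one (exactly dilation and rotation invariant), with equal cos_μ-nesting
transforms on all such φ,
coincide in law; then SchrammSmirnov2011 Cor 5.2 (crossing events are continuity events) gives
ExpCovariance. C2 is the restricted,
pair-specific form of crux M1 of card magic-formula-rigidity (bare-class injectivity is believed
false; the pair version with
complementary exact symmetry groups is the bet). Recorded alternative child: a direct ℤ² ↔ polar-web
universality coupling (no
isoradial structure — closed train tracks — so GrimmettManolescu/DKKMO transport does not start).
Other foreseen splits:
CardyRigiditySeq ⇐ LoewnerSubseqLimits(f) → LocalityForcesSix → CardyRigiditySeq;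
DomainEquicontinuity ⇐ SS11-type perturbation
lemma for discreteCrossing → arc/mark bookkeeping → DomainEquicontinuity.

KILL CRITERIA. A witness (rigorous, or a Monte-Carlo gap stable in δ) that P_δ(R) − P_δ(exp R) ↛ 0
for one pair refutes ExpCovariance and, through
ExpGeneratesConformal + CardyRigiditySeq, conformal invariance of bond-ℤ² itself: close
`refuted:ExpCovariance` and report at summit
level. ¬DomainEquicontinuity by a wild-boundary witness is NOT a kill: restate (a) for polygonal/C¹
rectangles plus a monotone
sandwich item. ¬ExpGeneratesConformal as typed means the continuity topology is wrong: restate with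
quad-uniform convergence.
¬CardyRigiditySeq is impossible unless Cardy fails (its hypothesis then holds with f = F). X_U
(stmt-CriticalPhenomena-0745) or
SLE6LimitZ2 proved elsewhere ⇒ close superseded. If C1 is shown to need the full twisted spectrum
beyond reach AND C2 is refuted on the
pair, the route degrades to a reformulation: close exhausted with census.

NOT DECOMPOSED YET. The engine children C1/C2 of ExpCovariance (they need the definition requests
below and the Literature fact DKLM Cor 10); the
interior of CardyRigiditySeq (hitting-kernel skeleton, AB regularity, Loewner parametrisability);
the countable dense family and
diagonal extraction inside CovarianceGlue; the Carathéodory / Koebe / zipper facts inside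
ExpGeneratesConformal (tree facts
`MarkedDomain.exists_isUniformizing`, `ConformalEquiv.exists_continuousOn_extension` enter as
hypotheses of its proof, not as items);
exact lattice-translation / conjugation equivariance of `discreteCrossing` and the topological lemma
'carrier + labelled marked points determine the arcs of a MarkedDomain' (lemmas under
TranslationCovariance / ReflectionSymmetry via --supports).

CHEAPEST FALSIFIER. Redo LPS Table 3.5 at modern sizes (a refuter kit Monte-Carlo, not run here —
the hub is compute-free and this seat plans): on δℤ²
compare (i) the crossing probability of the planar annular sector {1 < |z| < e^{π/2}, 0 < arg z < π}
between its two radial sides with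
(ii) that of the rectangle (0, π/2) × (0, π) between its vertical sides (= (i) pulled back by Log;
both have limit F(η) under Cardy),
for δ = 1/50 … 1/800, 10⁶ samples each: ExpCovariance predicts the difference → 0; a gap > 3σ that
does not shrink with δ kills
ExpCovariance and with it conformal invariance on ℤ². LPS (r₁ = 100, 10⁵ samples) saw .4316/.4356
(annulus int/ext) vs .4424
(cylinder), a 1e-2 gap they attributed to the small inner radius. Second cheap check (lookup, done):
Kozlowski2018 Prop 4.2 / Thm 4.3
prove the conformal 1/L spectrum only for root density D < 1/2 — the percolation sector D = 1/2 is
excluded, so C1 is NOT a corollary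
of existing Bethe-ansatz theorems (recorded in its why-it-might-fail).

NUMBERS. σ² = 2/arccos(−√q/2) = 3/π at q = 1 (arXiv:2603.06268 Thm 8 / Cor 10); μ = 1/6, loop weight
2cos(π/3) = 1, quarter-turn phase
e^{±iπ/12}, c = 2cos(π/6) = √3, Δ = −1/2; untwisted cylinder BKW gives wrapping loops weight 2 (seam
twist needed). LPS Table 3.5
(r₁ = 100, r₂ = 1000, 10⁵ samples): interior .4316 .4306 .2539 / exterior .4356 .4348 .2586 /
cylinder .4424 .4399 .2637; their
202 × 240 periodic strip (ratio 198) gave .5003/.4990/.3224 ≈ square values. Kozlowski2018: 1/L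
expansion (Prop 4.2) for 0 ≤ D < 1/2
only. Items at open: 9 (target, 4 cruxes, 3 support, assembly); after open: 1 informal crux (C1) + 2
definition requests + 1 cite.

DEFINITION REQUESTS. - `ConformalRectangle.imageUnivalent` (topic
Literature/Probability/RandomPlanarGeometry): the image of a marked Jordan domain under
  a map holomorphic and injective on a neighbourhood of its closure (carrier = image, boundary = h ∘
boundary, same marks), with the
  lemma that uniformizing data transport and crossRatio is preserved — used by
ExpGeneratesConformal, by instances of ExpCovariance,
  and by CardyViaSLE6's conformal-covariance crux.
- `cylinderLoopCollection N Λ` / `cosMuNestingTransform` (topic Literature/Probability/Percolation):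
interface loops of bond
  percolation on ℤ × ZMod N embedded by (k, j) ↦ exp((2π/N)(k + ij)) as a `LoopSpace ℂ` random
variable (mirror of
  `bondLoopCollection`), and the nesting transform L ↦ ∏_ℓ 2cos(φ(int ℓ) + π/3) — for the engine
child C1.
- cite fact wanted: DKLM Cor 10 (arXiv:2603.06268): Gaussian limit exp(−½σ²‖φ‖²_∇) of the cos_μ
nesting transform of critical
  FK(q) loops on δℤ², q ∈ [1,4] (q = 1: bond percolation), for mass-zero finite-energy test
functions.

Novelty: Searches (2026-08-15): `ledger idea list --sub CardyFormulaZ2` (120 cards; read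
cylinder-exp-covariance, squaring-covariance-cone-graph,
z2-is-its-own-logarithm, magic-formula-rigidity, boundary-dklm in full) and the six route files;
`ledger negatives --problem
CriticalPhenomena` (1, SAW, unrelated); `lean search` for six-vertex / GFF / nesting facts (none in
tree) and for modulus functionals
(found `IsModulusFunction`, `IsShearCovariant`, `dkkmo_rotation_invariance`, `bondLoopCollection`);
`lit read arXiv:2603.06268`
(Thm 8, Cor 10 p.13, §4.5.1 Lemma 22, Cor 18, Remark 9), `lit read arXiv:1508.05741` (Prop 4.2, Thm
4.3: D < 1/2 only), `lit read
arXiv:math/9401222 --grep cylinder` (§3.5 pp.27–28, Table 3.5), `lit read arXiv:1101.5820` (Lemma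
5.1, Cor 5.2, Lemma 6.1);
`lit search --hybrid "Koebe osculation …"` (8 docs, Schramm circle-packing survey, Jin 2018); `lit
galaxy search "osculation method"
--star all` (6 panama hits: Bieberbach, Henrici vol.3; pdf star saturated); crossref:
MarshallRohde2007 doi:10.1137/060659119,
Cardy1984 doi:10.1088/0305-4470/17/7/003; OpenAlex/arXiv APIs rate-limited (429).
Nearest prior art found: Cardy1984 (log map ⇒ cylinder finite-size spectra are conformal data — the
title thesis, in print);
arXiv:math/9401222 §3.5 Table 3.5 (annulus vs "conformally equivalent cylinder" numerics = an
exp-covariance test, 1994); card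
squaring-covariance-cone-graph (graded variant: one-map generation via Lie + z² orbifold) and
retired duplicate
z2-is-its-own-lo  [refs: 10.1137/060659119, 10.1088/0305-4470/17/7/003, 2603.06268, 1508.05741, math/9401222, 1101.5820, doi:10.1137/060659119, doi:10.1088/0305-4470/17/7/003, MarshallRohde2007, Cardy1984]

Barriers (technique_class: one-map-covariance exp-cylinder gen-lemma finite-aspect-bethe): - technique_class: one-map-covariance exp-cylinder gen-lemma finite-aspect-bethe
- Literature.Barriers.CriticalPhenomena.EmbeddingModulusUniqueness: applies to the target and to
ExpCovariance (each implies IsModulusFunction of the limit functional) and is evaded, not ignored: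
ExpCovariance is FALSE for every stretched copy diag(1,p)ℤ², p ≠ 1 (it forces rotation invariance
through Log), so no shear-covariant / RSW-only argument can prove it and none is proposed; the
engine's embedding-specific inputs are exactly those of arXiv:2603.06268 Thm 8 — DKKMO rotation
invariance of the isotropic model on the SQUARE embedding ([magicformula] Thm 12 there; weights ↔
embedding is their Thm 11) and the Bethe-ansatz stiffness σ² = 3/π; under an axis stretch both
Gaussian kernels stretch while exp does not commute with the stretch, so T_plane ≠ T_polar and the
identification child C2 correctly fails for diag(1,p)ℤ²; ExpGeneratesConformal and CardyRigiditySeq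
carry the symmetry inside their hypotheses (the exemption the barrier grants
CardyRotToConfR2SymmetryUpgrade).
- Literature.Barriers.CriticalPhenomena.SmirnovTriangularOnly: does not apply — no colour switching,
no discrete-holomorphic observable, no order-3 symmetry.
- Literature.Barriers.CriticalPhenomena.FKParafermionicHalfCauchyRiemann: does not apply — the
six-vertex input is the height-function Gaussian limit, not the q = 1 parafermion's half
Cauchy–Riemann relations; no boundary-value problem is solved.
- Literature.Barriers.Crit

History (route lifecycle, newest last):
- 2026-08-15T11:40:29Z · rev 1: dropped stmt-CriticalPhenomena-5034 — dedupe: stmt-5034 is an accidental duplicate of stmt-5031 (same informal crux CylinderNestingGaussian filed twice during a farm retry); keep 5031 (planner-plancard-CriticalPhenomena-CardyFormu-4fb33c41-0)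
- 2026-08-16T03:50:10Z · AUTO-CRUX (backfill): SubseqConformalInvariance — hypotheses of the deciding theorem that nothing in the route derives are cruxes (operator:999:586464)
- 2026-08-24T05:42:02Z · DORMANT — reconciler: no traction for 6.6 d (last activity item-evidence-added at 2026-08-17T15:24:43Z); parked, not closed — `ledger route dormant route-CriticalPhenomen (operator:999:3421980)

sub-problem: CardyFormulaZ2 · status: dormant · opened planner-plancard-CriticalPhenomena-CardyFormu-4fb33c41-0 2026-08-15T11:34:48Z · rev 3 · ledger route-CriticalPhenomena-CardyExpCovariance
GENERATED by the gate from the ledger (D-0016/17). Provers cite these decls: `theorem foo : Summit.CriticalPhenomena.CardyFormulaZ2.Theses.CardyExpCovariance.<Decl> := …` in Summits/CriticalPhenomena/CardyFormulaZ2/Theorems/<Name>.lean.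
-/

namespace Summit.CriticalPhenomena.CardyFormulaZ2.Theses.CardyExpCovariance

open scoped BigOperators Topology Manifold Classical MeasureTheory ProbabilityTheory Matrix InnerProductSpace ComplexConjugate ContinuousMap
open Filter Set Function TopologicalSpace MeasureTheory

attribute [summit_statement] _root_.CardyFormulaZ2

/-- item stmt-CriticalPhenomena-4678 · crux (kind.auto-crux: conjecture-grade) · rank 0 · open · by planner
why it might fail: As strong as conformal invariance of every subsequential bond-Z^2 crossing limit (open: LPSA1994 §2, BollobasRiordan2006 Ch.7 Conj.1, Schramm2007ICM Prob.2.11); implied by CardyFormulaZ2, so it fails only with the conjunct; no embedding-blind proof reaches it (EmbeddingModulusUniqueness).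
sources: arXiv:math/9401222, BollobasRiordan2006, Schramm2007ICM, Beffara2008Universal, SchrammSmirnov2011, lean:Literature.Barriers.CriticalPhenomena.EmbeddingModulusUniqueness
[target] for every sequence u_k → 0⁺ there are a subsequence ψ and f : ℝ → ℝ such that for every
conformal rectangle R and every uniformizing datum (φ, x) of R, bondDomainCrossingProb R (u (ψ k)) →
f (crossRatio x) (card item X_U-subsequential; existence along common subsequences + conformal
invariance, value free). -/
@[route_item "route-CriticalPhenomena-CardyExpCovariance", crux]
def SubseqConformalInvariance : Prop :=
  ∀ u : ℕ → ℝ, Filter.Tendsto u Filter.atTop (nhdsWithin 0 (Set.Ioi 0)) → ∃ (ψ : ℕ → ℕ) (f : ℝ → ℝ), StrictMono ψ ∧ ∀ (R : Literature.Probability.RandomPlanarGeometry.ConformalRectangle) (φ : Literature.Probability.RandomPlanarGeometry.ConformalEquiv UpperHalfPlane.upperHalfPlaneSet R.carrier) (x : Fin 4 → ℝ), R.IsUniformizing φ x → Filter.Tendsto (fun k ↦ Literature.Probability.Percolation.bondDomainCrossingProb R (u (ψ k))) Filter.atTop (nhds (f (Literature.Probability.RandomPlanarGeometry.crossRatio 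x)))

/-- item stmt-CriticalPhenomena-4679 · crux · rank 2 · open · by planner
why it might fail: Conformal invariance minus existence: via Log it forces rotation AND scale invariance of each subsequential limit; false for every stretched lattice diag(1,p)Z^2 (Beffara Prop.4), so it needs an embedding-specific input, none in print (DKKMO stops at rotations; LPS Tab.3.5: 1e-2 annulus/cyl. gap).
sources: arXiv:math/9401222, Cardy1984, arXiv:2603.06268, DKKMO2020Rotational, Beffara2008Universal, lean:Literature.Barriers.CriticalPhenomena.EmbeddingModulusUniqueness
[crux] for conformal rectangles R, R' with exp injective on closure(R.carrier), R'.carrier =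
exp(R.carrier) and R'.pt i = exp(R.pt i), the bond-ℤ² crossing probabilities satisfy P_δ(R) −
P_δ(R') → 0 as δ → 0⁺ (card C1/C2 target: "polar web = cylinder lattice" makes P_δ(R) an exact
cylinder quantity; the comparison with the planar lattice in exp R is the content). [difficulty:
open-problem] -/
@[route_item "route-CriticalPhenomena-CardyExpCovariance", crux]
def ExpCovariance : Prop :=
  ∀ (R R' : Literature.Probability.RandomPlanarGeometry.ConformalRectangle), Set.InjOn Complex.exp (closure R.carrier) → R'.carrier = Complex.exp '' R.carrier → (∀ i, R'.pt i = Complex.exp (R.pt i)) → Filter.Tendsto (fun δ ↦ Literature.Probability.Percolation.bondDomainCrossingProb R δ - Literature.Probability.Percolation.bondDomainCrossingProb R' δ) (nhdsWithin 0 (Set.Ioi 0)) (nhds 0)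

/-- item stmt-CriticalPhenomena-4680 · crux · rank 3 · open · by planner
why it might fail: Not in print with an UNKNOWN conformally invariant 4-point kernel f along one sequence: Smirnov2001 Thm 2 / CamiaNewman2007 §5-7 run 'kernel => SLE6' with explicit F in admissible moving-mesh (non-Jordan) domains (CN2007 p.489: Jordan-only may not suffice); Schramm's principle needs the curve law.
sources: CamiaNewman2007, Schramm2000, LawlerSchrammWerner2001, KemppainenSmirnov2017, arXiv:0909.4499, lean:Literature.Probability.RandomPlanarGeometry.eq_six_of_forall_measureReal_hitsBefore
[crux] sequential Cardy rigidity: if along SOME sequence u_k → 0⁺ the bond-ℤ² crossing probabilities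
of every conformal rectangle converge to f(cross-ratio), then f = cardyFunction on (0,1) (locality
of percolation forces the exploration limit along u_k to be SLE₆, whose crossing law is Cardy's);
strengthens CardyUniqueLimit.CardyRigidity (stmt-CriticalPhenomena-0746: full-filter hypothesis) and
is what turns uniqueness into existence. [difficulty: L] -/
@[route_item "route-CriticalPhenomena-CardyExpCovariance", crux]
def CardyRigiditySeq : Prop :=
  ∀ (u : ℕ → ℝ) (f : ℝ → ℝ), Filter.Tendsto u Filter.atTop (nhdsWithin 0 (Set.Ioi 0)) → (∀ (R : Literature.Probability.RandomPlanarGeometry.ConformalRectangle) (φ : Literature.Probability.RandomPlanarGeometry.ConformalEquiv UpperHalfPlane.upperHalfPlaneSet R.carrier) (x : Fin 4 → ℝ), R.IsUniformizing φ x → Filter.Tendsto (fun k ↦ Literature.Probability.Percolation.bondDomainCrossingProb R (u k)) Filter.atTop (nhds (f (Literature.Probability.RandomPlanarGeometry.crossRatio x)))) → Set.EqOn f Literature.Probability.RandomPlanarGeometry.cardyFunction (Set.Ioo 0 1)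

/-- item stmt-CriticalPhenomena-4682 · crux · rank 5 · open · by planner
why it might fail: delta0 is fixed before S, which varies below the mesh: if arc 1 of R is a positive-area (Osgood) arc of area > area(R), an eta-perturbation fills eta-boxes along it with lattice points, links them, cuts them off the core below delta; meshDomain (max ncard) = the blob, no arc-0 sites, P(S)=0<c<P(R).
sources: SchrammSmirnov2011, GarbanPeteSchramm2013, Grimmett1999, doi:10.1090/S0002-9947-1903-1500628-5, lean:Literature.Probability.LatticeModels.meshDomain, lean:Literature.Probability.LatticeModels.discreteArc
[crux] RSW equicontinuity of bond-ℤ² crossing probabilities in the domain, for G02's discretisation: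
for every conformal rectangle R and ε > 0 there are η, δ₀ > 0 such that every near-identity
perturbation S = h(R) (h continuous injective on closure R, marks mapped to marks, sup|h − id| ≤ η)
has |P_δ(S) − P_δ(R)| ≤ ε for all δ < δ₀ (Schramm–Smirnov quad-perturbation stability transplanted
to discreteCrossing; feeds both the diagonal extraction and hypothesis (a) of the generation lemma).
[difficulty: M] -/
@[route_item "route-CriticalPhenomena-CardyExpCovariance", crux]
def DomainEquicontinuity : Prop :=
  ∀ (R : Literature.Probability.RandomPlanarGeometry.ConformalRectangle) (ε : ℝ), 0 < ε → ∃ η : ℝ, 0 < η ∧ ∃ δ₀ : ℝ, 0 < δ₀ ∧ ∀ (S : Literature.Probability.RandomPlanarGeometry.ConformalRectangle) (h : ℂ → ℂ), ContinuousOn h (closure R.carrier) → Set.InjOn h (closure R.carrier) → S.carrier = h '' R.carrier → (∀ i, S.pt i = h (R.pt i)) → (∀ z ∈ closure R.carrier, ‖h z - z‖ ≤ η) → ∀ δ ∈ Set.Ioo 0 δ₀, |Literature.Probability.Percolation.bondDomainCrossingProb S δ - Literature.Probability.Percolation.bondDomainCrossingProb R δ| ≤ ε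

/-- item stmt-CriticalPhenomena-4681 · support · rank 4 · open · by planner
why it might fail: Hypothesis (a) must carry g through zipper/Koebe approximants AND interior exhaustion of wild Jordan R, which needs Carathéodory's homeomorphic boundary extension (tree facts exists_isUniformizing / exists_continuousOn_extension, unproved); a too-weak topology in (a) makes it unprovable as typed.
sources: book:remmert1998-classical-topics-complex-function-theory, Pommerenke1992, AhlforsCA1979, MarshallRohde2007, lean:Literature.Barriers.CriticalPhenomena.IsModulusFunction, lean:Literature.Probability.RandomPlanarGeometry.JordanDomain.exists_continuousOn_extension
[crux] generation lemma (pure complex analysis): a functional g on conformal rectangles that is (a)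
continuous under near-identity continuous injective perturbations h of the closed marked domain
(S.carrier = h(R.carrier), S.pt i = h(R.pt i), sup|h − id| ≤ η on closure R), (b) invariant under
translations, (c) invariant under R ↦ exp R whenever exp is injective on closure(R.carrier) and (d)
invariant under complex conjugation of the marked domain, is a function of the conformal modulus
(IsModulusFunction g; (d) is needed because uniformizing tuples may be monotone or antitone and
crossRatio is blind to x ↦ −x (crossRatio_neg), so equal cross-ratios relate R, R' by a conformal OR
anti-conformal map respecting labels — without (d) the orientation sign of the labelled marks is a
counterexample; (a) with h = id already makes g a function of (carrier, labelled marks)). Proof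
plan: (b)+(c) give similarities (exp∘(+c)∘Log), inversion and powers z^α, hence all Möbius maps;
Koebe osculation / slit-zipper compositions approximate every map univalent near a closed disc
uniformly (MarshallRohde2007); interior exhaustion by the Riemann map + (a) passes g to the limit;
(d) absorbs the anti-confo -/
@[route_item "route-CriticalPhenomena-CardyExpCovariance", crux]
def ExpGeneratesConformal : Prop :=
  ∀ g : Literature.Probability.RandomPlanarGeometry.ConformalRectangle → ℝ, (∀ (R : Literature.Probability.RandomPlanarGeometry.ConformalRectangle) (ε : ℝ), 0 < ε → ∃ η : ℝ, 0 < η ∧ ∀ (S : Literature.Probability.RandomPlanarGeometry.ConformalRectangle) (h : ℂ → ℂ), ContinuousOn h (closure R.carrier) → Set.InjOn h (closure R.carrier) → S.carrier = h '' R.carrier → (∀ i, S.pt i = h (R.pt i)) → (∀ z ∈ closure R.carrier, ‖h z - z‖ ≤ η) → |g S - g R| ≤ ε) → (∀ (R S : Literature.Probability.RandomPlanarGeometry.ConformalRectangle) (a : ℂ), S.carrier = (fun z ↦ z + a) '' R.carrier → (∀ i, S.pt i = R.pt i + a) → g S = g R) → (∀ (R S : Literature.Probability.RandomPlanarGeometry.ConformalRectangle),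 Set.InjOn Complex.exp (closure R.carrier) → S.carrier = Complex.exp '' R.carrier → (∀ i, S.pt i = Complex.exp (R.pt i)) → g S = g R) → (∀ (R S : Literature.Probability.RandomPlanarGeometry.ConformalRectangle), S.carrier = (starRingEnd ℂ) '' R.carrier → (∀ i, S.pt i = (starRingEnd ℂ) (R.pt i)) → g S = g R) → Literature.Barriers.CriticalPhenomena.IsModulusFunction g

-- item stmt-CriticalPhenomena-5031 · support · rank 6 · open · by planner — informal only, no Lean statement yet:
--   [crux] CylinderNestingGaussian — engine child C1 of ExpCovariance (card cylinder-exp-covariance C1;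
--   foreseen split ExpCovariance ⇐ CylinderNestingGaussian → PairIdentification → ExpCovariance). For
--   bond percolation at p = 1/2 on the cylinder graph ℤ × ZMod N embedded in ℂ∖0 by (k, j) ↦
--   exp((2π/N)(k + i j)) — i.e. on the polar web exp((2π/N)ℤ²), which is graph-isomorphic to the square
--   lattice on the cylinder — and every mass-zero finite-Dirichlet-energy test function φ compactly
--   supported in ℂ∖0: E[∏_{loops ℓ} 2cos(φ(int ℓ) + π/3)] → exp(−(3/2π)‖φ‖²_∇) as N → ∞, where int ℓ is
--   the bounded compl

/-- item stmt-CriticalPhenomena-4683 · support · rank 9 · open · by planner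
sources: SchrammSmirnov2011, Grimmett1999
[support] translation covariance in the limit: if S is the translate of R by a ∈ ℂ (carrier and
marked points), then P_δ(R) − P_δ(S) → 0 as δ → 0⁺ (exact for a ∈ δℤ² by equivariance of
discreteCrossing and of bondPercolation; the O(δ) remainder by DomainEquicontinuity). [difficulty:
provable-now] -/
@[route_item "route-CriticalPhenomena-CardyExpCovariance", crux]
def TranslationCovariance : Prop :=
  ∀ (R S : Literature.Probability.RandomPlanarGeometry.ConformalRectangle) (a : ℂ), S.carrier = (fun z ↦ z + a) '' R.carrier → (∀ i, S.pt i = R.pt i + a) → Filter.Tendsto (fun δ ↦ Literature.Probability.Percolation.bondDomainCrossingProb R δ - Literature.Probability.Percolation.bondDomainCrossingProb S δ) (nhdsWithin 0 (Set.Ioi 0)) (nhds 0)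

/-- item stmt-CriticalPhenomena-4684 · support · rank 9 · open · by planner
sources: Smirnov2001, Grimmett1999
[support] exact mirror symmetry: if S is the complex conjugate of R (carrier conj(R.carrier), marked
points conj(R.pt i)), then P_δ(S) = P_δ(R) for every δ (conj maps δℤ² to itself; meshDomain takes
the union of all maximal components, discreteArc compares distances — both conj-equivariant;
bondPercolation is invariant under the graph automorphism). Supplies hypothesis (d) of the
generation lemma. [difficulty: provable-now] -/
@[route_item "route-CriticalPhenomena-CardyExpCovariance", crux]
def ReflectionSymmetry : Prop :=
  ∀ (R S : Literature.Probability.RandomPlanarGeometry.ConformalRectangle) (δ : ℝ), S.carrier = (starRingEnd ℂ) '' R.carrier → (∀ i, S.pt i = (starRingEnd ℂ) (R.pt i)) → Literature.Probability.Percolation.bondDomainCrossingProb S δ = Literature.Probability.Percolation.bondDomainCrossingProb R δ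

/-- item stmt-CriticalPhenomena-4685 · support · rank 9 · open · by planner
sources: Beffara2008Universal, SchrammSmirnov2011
[support] layer-2 glue: ExpCovariance → TranslationCovariance → ReflectionSymmetry →
DomainEquicontinuity → ExpGeneratesConformal → SubseqConformalInvariance (diagonal extraction over a
countable family of rational polygonal rectangles dense for near-identity perturbations; the
subsequential limit functional g inherits (a)–(d); IsModulusFunction g gives f by choice).
[difficulty: M] -/
@[route_item "route-CriticalPhenomena-CardyExpCovariance", crux]
def CovarianceGlue : Prop :=
  ExpCovariance → TranslationCovariance → ReflectionSymmetry → DomainEquicontinuity → ExpGeneratesConformal → SubseqConformalInvariance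

/-- item stmt-CriticalPhenomena-4686 · assembly · rank 1 · open · by planner
sources: arXiv:0909.4499, Schramm2000
[assembly] SubseqConformalInvariance → CardyRigiditySeq → CardyFormulaZ2 (every sequence has a
subsequence converging to F(η); countably generated filter). -/
@[route_item "route-CriticalPhenomena-CardyExpCovariance", crux]
def Assembly : Prop :=
  SubseqConformalInvariance → CardyRigiditySeq → CardyFormulaZ2

/-! D-0027 §2.1 — DECIDING THEOREM (planner-authored via `route open/edit --closes-file`; by planner-rbadge-CriticalPhenomena-CardyExpCovar-af43b29d-g4-0 2026-08-15T16:12:02Z):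
its hypotheses are this route's items and its conclusion the sub-problem Statement (glue_lint), and it elaborates with this file. -/

@[closes "route-CriticalPhenomena-CardyExpCovariance"] theorem closes (_h0 : SubseqConformalInvariance) (h2 : ExpCovariance) (h3 : CardyRigiditySeq)
    (h4 : ExpGeneratesConformal) (h5 : DomainEquicontinuity) (h6 : TranslationCovariance)
    (h7 : ReflectionSymmetry) (h8 : CovarianceGlue) (_h1 : Assembly) :
    _root_.CardyFormulaZ2 := by
  -- D-0027 §2.1 deciding theorem of route CardyExpCovariance: the typed items as hypotheses (route
  -- order; the informal engine child CylinderNestingGaussian has no decl yet and sits UNDER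
  -- ExpCovariance, so it is not a hypothesis), conclusion the sub-problem Statement by name.
  -- Layer 2 → layer 1: the covariance cruxes and supports give the target X through CovarianceGlue
  -- (the target hypothesis `_h0` and the optional `Assembly` item `_h1` are deliberately NOT used:
  -- the route decides the Statement from its crux layer).
  have hX : SubseqConformalInvariance := h8 h2 h6 h7 h5 h4
  -- Layer 1 → Statement (pure logic + `𝓝[>] 0` countably generated): fix R and a uniformizing
  -- datum (φ, x); it suffices that every sequence u → 0⁺ has a subsequence along which
  -- P(R, u ∘ ψ) → F(crossRatio x). X gives ψ and a conformally invariant subsequential limit f;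
  -- sequential Cardy rigidity along u ∘ ψ pins f = F on (0,1), and crossRatio x ∈ (0,1).
  intro R φ x hφ
  refine Filter.tendsto_of_subseq_tendsto fun u hu => ?_
  obtain ⟨ψ, f, hψ, hf⟩ := hX u hu
  have huψ : Filter.Tendsto (u ∘ ψ) Filter.atTop (nhdsWithin 0 (Set.Ioi 0)) :=
    hu.comp hψ.tendsto_atTop
  have hfF : Set.EqOn f Literature.Probability.RandomPlanarGeometry.cardyFunction (Set.Ioo 0 1) :=
    h3 (u ∘ ψ) f huψ fun R' φ' x' hφ' => hf R' φ' x' hφ'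
  have hη : Literature.Probability.RandomPlanarGeometry.crossRatio x ∈ Set.Ioo (0 : ℝ) 1 :=
    Literature.Probability.RandomPlanarGeometry.ConformalRectangle.crossRatio_mem_Ioo_of_isUniformizing hφ
  refine ⟨ψ, ?_⟩
  have hlim := hf R φ x hφ
  rw [hfF hη] at hlim
  exact hlim

end Summit.CriticalPhenomena.CardyFormulaZ2.Theses.CardyExpCovariance
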